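import Literature.MathematicalPhysics.QuantumFieldTheory.Balaban1983to89.Node00.N24NodesStage13XReboundPointedAtFamilies
import Literature.MathematicalPhysics.QuantumFieldTheory.Balaban1983to89.Node00.Record13CarriersXPinned

/-!
# BalabanUVNodes ∕ N10 — THE K1‴ ENGINE'S CLOSERS AT THE X-PINNED CARRIERS OF RECORD `X' := XPinned₁₃ F N θ lam8 lam12 lam13`: dag-n24-c's modules 43 (θ- and X'-generic) and 44
# (at node00-def-K0a's Stage-13 witness families) BY NAME, with the three X-reading sockets — N05 `h05`, N09 `h09`, N10 `h10` — READ AS THE THREE LEAVES OF RECORD at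
# `(lam8, lam12, lam13)` and every other socket θ-keyed (Track A, DAG node N10 [B13] ∕ binder N24; strategy s2; seat `pub-ymgap-dag-n10-d` g7 — the «closer» dag-ref-D READ-174∕175
# records as not done; composite, count-neutral)

HONEST FRAMING.  Count-neutral kernel bookkeeping BY NAME over LANDED modules: dag-n24-c's module 43 `N24NodesStage13XReboundPointed` (p499444; the thirteen nodes, item K1‴'s
θ-keyed consequent and the rung body `BetaWindowAtSomeRecord13` over the four-pin Stage-13 view of `θ.rebindX X'`, every X-reading socket at `X' P`, every other socket at θ's own
histories) and module 44 `N24NodesStage13XReboundPointedAtFamilies` (p499899; the same at K0a's members `theta13LiveOfNumerics …` ∕ `theta13LiveOfFamily₂ …` with `Admissible`,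
`SlotsNondegenerate₁₃`, (R₁₃) theorems there), and this seat's `Node00/Record13CarriersXPinned` (p497764: the combined carrier map `XPinned₁₃`, the one-level pin
`Stage13Params.pinX3 := θ.rebindX (XPinned₁₃ …)`, the socket identities `socket05∕09∕10_pinX3_iff : Iff.rfl`).  WHY (dag-n10-d g6 LOCATED-N24-XSOCKET, dag-lead DEDUP-251∕252 (R3),
dag-ref-D READ-174∕175): at every K0a witness the residual carrier family `res.X` is the degenerate `Classical.choice` one, so the engine's X-reading sockets are served ONLY at an
X-pinned parameter; module 43 made the engine X'-generic; THIS FILE TAKES `X' :=` THE CARRIERS OF RECORD and reads the three sockets as the three nodes' LEAVES: N05 ← dag-n05-d's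
typed [B8″] leaf form at `lam8` (the right-hand side of `Record13CarriersB8SubB.upOfRecord₅C_toStage5₁₃_pinB8SubB_b8_iff`, C-binding form AS TYPED in the engine), N09 ←
`B12Sec2to5.Lemma4Printed (F12OfRecord₁₂ F N θ.toStage12Params lam12 P) (lam12 P).consts` (node00-def g32's frame of record), N10 ← `B13LeafOfRecord θ₃ (lam13 P)` (node00-def-B13's
group of record; this seat's junctions `b13LeafOfRecord_of_located(_termwise ∕ _walks …)` conclude exactly it).  Every proof is ONE application of module 43 ∕ 44 at
`X' := XPinned₁₃ F N θ lam8 lam12 lam13` with `h05 ∕ h09 := (socket0k_pinX3_iff …).2 (h0k P)` and `h10 := fun P _ _ _ _ => (socket10_pinX3_iff …).2 (h10 P)` (the in-edge antecedents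
of N10's socket are not needed once the leaf is given); `hup` is displayed over `(θ.pinX3 F N lam8 lam12 lam13).view₁₃B10YZW …` (definitionally module 43's
`(θ.rebindX F N X').view₁₃B10YZW …`, `pinX3_eq_rebindX`).  COMPOSITE: every socket is a hypothesis (the three leaves included); `hP : Provisos₁₃` DISPLAYED (K0‴ stmt-QuantumFields-19909,
director-ym HOLD №136∕№138 — no `.bg` consumer here); nothing discharged; NOT `stub_nodes13` ∕ `stub_betaWindow13`; nothing of Bałaban's asserted; N05 ∕ N09 ∕ N10 ∕ N24 NOT discharged;
no count moves (typed 28∕28 · discharged 5∕27); one finite four-torus programme at fixed ε per run; nothing continuum ∕ ℝ⁴ ∕ OS ∕ mass-gap ∕ Clay.  0 `sorry`, 0 `def`, 0 `instance`,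
0 `notation`, standard axioms.  Filed `--supports` K1‴ «StabilityBAtRecordR13e» (stmt-QuantumFields-19910) of route «BalabanUVNodes» (re-keyed to K1⁗ by the rev-18 token map
`Provisos₁₃ ↦ …`, `datumOfRecord₁₃ ↦ …` when plan's KEY line and dag-lead WORDS-140 are in; nothing else changes).

WHAT THIS FILE PROVES.  §1 (θ-generic) `nodes₁₃_pinX3_of_leaves`, ★ `stabilityBR13e_thetaShape16_pinX3_of_leaves`, ★ `betaWindowAtSomeRecord₁₃_pinX3_of_leaves_of_boxH`;
§2 (at K0a's members) ★ `stabilityBR13e_thetaShape16_pinX3_of_leaves_theta13LiveOfNumerics`, `betaWindowAtSomeRecord₁₃_pinX3_of_leaves_theta13LiveOfNumerics_of_boxH`,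
★ `stabilityBR13e_thetaShape16_pinX3_of_leaves_theta13LiveOfFamily₂`, `betaWindowAtSomeRecord₁₃_pinX3_of_leaves_theta13LiveOfFamily₂_of_boxH`.
-/

noncomputable section

namespace Summit.QuantumFields.YangMills.BalabanUVNodes.N10XPinnedClosers13

open Literature.MathematicalPhysics.QuantumFieldTheory.Balaban1983to89
open Literature.MathematicalPhysics.QuantumFieldTheory.Balaban1983to89.T4Continuum
open Literature.MathematicalPhysics.QuantumFieldTheory.Balaban1983to89.T4DatumAssembly
open Literature.MathematicalPhysics.QuantumFieldTheory.Balaban1983to89.DagBinding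
open Literature.MathematicalPhysics.QuantumFieldTheory.Balaban1983to89.FlowStepRuns
open Literature.MathematicalPhysics.QuantumFieldTheory.Balaban1983to89.AveragingRT
open Literature.MathematicalPhysics.QuantumFieldTheory.Balaban1983to89.FlowStep (BetaLowerH BetaUpperH)
open Literature.MathematicalPhysics.QuantumFieldTheory.Balaban1983to89.B8IdxB8LawsB (IdxB8SubB famB8OfRecordSubB)
open Literature.MathematicalPhysics.QuantumFieldTheory.Balaban1983to89.Node00
open scoped Matrix.Norms.L2Operator

variable {F : T4Family} {N : ℕ} [NeZero N]

/-! ## §1. θ-generic: the engine at `X' := XPinned₁₃ F N θ lam8 lam12 lam13`, the three X-sockets ← the three leaves of record -/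

/-- **THE THIRTEEN DAG NODES AT A WORLD BOUND TO THE FOUR-PIN STAGE-13 VIEW OF THE X-PINNED PARAMETER `θ.pinX3 lam8 lam12 lam13`, THE THREE X-READING CHILDREN ← THEIR
LEAVES OF RECORD, EVERY OTHER SOCKET θ-KEYED** — dag-n24-c's module 43 `N24_nodes₁₃_rebindX_fourPin_pointed` at `X' := XPinned₁₃ F N θ lam8 lam12 lam13` with `h05 ∕ h09 ∕ h10`
supplied through `socket05∕09∕10_pinX3_iff` from dag-n05-d's [B8″] leaf form at `lam8`, Lemma 4 at the [B12] frame of record at `lam12`, and `B13LeafOfRecord θ₃ (lam13 P)`.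
COMPOSITE; nothing discharged. [cite: Balaban1985RegularSpaces, Thm 2 p.83; Balaban1987RG1, Lemma 4 p.280, Thm 1 p.259, Thm 3 p.264, (1.22) p.264, (2.9) p.266; Balaban1988RG2Cluster, Lemmas 1–3 pp.9, 11, 20; Balaban1989LargeFieldII, Thm 1 p.355, (0.1) pp.355–356, p.391; Balaban1985UV3, Thm 1 p.257 + Thm 2 p.272; Balaban1985BackgroundPropagators, Thm 3.1 p.397; Balaban1985Variational, Thm 1 p.279; Balaban1988Convergent, Thm 1 p.262, (2.18) p.257, Cor. 3 (2.50) p.264, (3.16)–(3.22) pp.268–269; Balaban1989LargeFieldI, Prop. 1 p.194, (0.2)–(0.4) p.176 (bookkeeping)] -/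
theorem nodes₁₃_pinX3_of_leaves (θ : Stage13Params F N) (hP : θ.Provisos₁₃ F N) (hθ : θ.Admissible F N)
    (lam8 : ResidB8 θ.toStage3Params) (lam12 : ResidB12 F N θ.τ9.M) (lam13 : B12.RunParams → ResidB13 θ.toStage3Params) (Mstar : ℕ) (ops : OpsY N θ.toStage3Params Mstar) (ζ : ResidZ F N)
    (lamW : ResidW F N) (w : WorldP) (hC : w.C = (datumOfRecord₁₃ F N θ hP).C) (hγ : 0 < w.γ ∧ w.γ ≤ θ.γ) (hL : w.L = (θ.L : ℝ))
    (hup : ∀ P, w.up P = upOfRecord₅C F N ((θ.pinX3 F N lam8 lam12 lam13).view₁₃B10YZW F N Mstar ops ζ lamW) P)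
    (h05 : ∀ P : B12.RunParams, B8LeafR θ.D (θ.L : ℝ) lam8.C₂ lam8.B₁' lam8.inp.B₀' lam8.B₁ lam8.B₂ lam8.c₁ lam8.inp lam8.B₀β
      (B8Lemma1NonAbelian.blockPairNA θ.D θ.L θ.𝔸) (fun j : IdxB8SubB θ.toStage3Params => famB8OfRecordSubB θ.toStage3Params lam8.β lam8.len j)
      lam8.lan lam8.cub (fun j => lam8.toAxial j.1))
    (h06 : B9LeafX (Y9OfRecord N θ.toStage3Params Mstar ops)) (h07 : B11Leaf (Z11OfRecord F N ζ)) (h08 : PrintedUV3V N θ.L)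
    (h09 : ∀ P : B12.RunParams, B12Sec2to5.Lemma4Printed (F12OfRecord₁₂ F N θ.toStage12Params lam12 P) (lam12 P).consts)
    (h09T : ∀ P : B12.RunParams, (leavesP w P).smallCouplings → (leavesP w P).smallFieldInductive) (h10 : ∀ P : B12.RunParams, B13LeafOfRecord θ.toStage3Params (lam13 P))
    (h11 : ∀ P : B12.RunParams, (leavesP w P).b7 → (leavesP w P).b8 → (leavesP w P).b9 → (leavesP w P).b10 → (leavesP w P).b11 →
      (leavesP w P).smallCouplings → (leavesP w P).smallFieldInductive → (leavesP w P).flowControl →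
        ∀ k, k < P.K → SLaw₁₃ F N θ P k → TLaw₁₃ F N θ P k)
    (h12 : ∀ P : B12.RunParams, B15Leaf (WOfRecord₁₃ F N θ lamW P)) (hR : ∀ (P : B12.RunParams) (k : ℕ), k < P.K → TLaw₁₃ F N θ P k → SLaw₁₃ F N θ P (k + 1))
    (hUV : ∀ P : B12.RunParams, (genFlow (betaOfRecord₁₃ F N θ) P.g0).InInterval w.γ P.K → ∀ k, k ≤ P.K → SLaw₁₃ F N θ P k →
      ∀ U : GaugeField (F.P P.K) k (SU N),
        chiβOfRecord₁₃ F N θ P.K (gOfRecord₁₃ F N θ P) k U *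
              Real.exp (-(1 / (gOfRecord₁₃ F N θ P k) ^ 2 * wilsonBGOfRecord F N θ.εbg P k U)
                - w.em (gOfRecord₁₃ F N θ P k) * (Fintype.card (Site (F.P P.K) k) : ℝ)) ≤ densOfRecord₁₃ F N θ P k U ∧
        densOfRecord₁₃ F N θ P k U ≤ Real.exp (w.ep (gOfRecord₁₃ F N θ P k) * (Fintype.card (Site (F.P P.K) k) : ℝ))) :
    IsRecordOfRecord₁₃C F N (datumOfRecord₁₃ F N θ hP) w ∧ ∀ P : B12.RunParams, Nodes (leavesP w P) :=
  N24_nodes₁₃_rebindX_fourPin_pointed θ hP hθ (XPinned₁₃ F N θ lam8 lam12 lam13) Mstar ops ζ lamW w hC hγ hL hup (fun P => (socket05_pinX3_iff F N θ lam8 lam12 lam13 P).2 (h05 P)) h06 h07 h08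
    (fun P => (socket09_pinX3_iff F N θ lam8 lam12 lam13 P).2 (h09 P)) h09T (fun P _ _ _ _ => (socket10_pinX3_iff F N θ lam8 lam12 lam13 P).2 (h10 P)) h11 h12 hR hUV

/-- **★ ITEM K1‴'s θ-KEYED CONSEQUENT WITNESSED BY `(θ, hP)`, CHILDREN OVER THE FOUR-PIN VIEW OF THE X-PINNED PARAMETER, N05 ∕ N09 ∕ N10 ← THEIR LEAVES OF RECORD** (module 43 §2
`N24_stabilityBR13e_thetaShape16_rebindX_fourPin_pointed` at `X' := XPinned₁₃ F N θ lam8 lam12 lam13`; guard `hU`, `Provisos₁₃`, admissibility, the nine carrier-blind sockets and the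
β-box pair displayed θ-keyed).  COMPOSITE; NOT the stub. [cite: Balaban1989LargeFieldII, Thm 1 p.355, (0.1) pp.355–356, p.391; Balaban1988Convergent, (3.16)–(3.22) pp.268–269; Balaban1987RG1, Thm 3 p.264, (0.17)–(0.21) pp.255–256 and (1.22) p.264, (2.9) p.266; Balaban1985RegularSpaces, Thm 2 p.83; Balaban1987RG1, Lemma 4 p.280; Balaban1988RG2Cluster, Lemmas 1–3 pp.9–20; Balaban1985UV3, Thm 1 p.257 (bookkeeping + elementary window)] -/
theorem stabilityBR13e_thetaShape16_pinX3_of_leaves (θ : Stage13Params F N) (hP : θ.Provisos₁₃ F N) (hθ : θ.Admissible F N) (hU : θ.ZtUnity F N ∧ θ.SlotsNondegenerate₁₃ F N)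
    (lam8 : ResidB8 θ.toStage3Params) (lam12 : ResidB12 F N θ.τ9.M) (lam13 : B12.RunParams → ResidB13 θ.toStage3Params) (Mstar : ℕ) (ops : OpsY N θ.toStage3Params Mstar) (ζ : ResidZ F N)
    (lamW : ResidW F N) (w : WorldP) (hC : w.C = (datumOfRecord₁₃ F N θ hP).C) (hγ : 0 < w.γ ∧ w.γ ≤ θ.γ) (hL : w.L = (θ.L : ℝ))
    (hup : ∀ P, w.up P = upOfRecord₅C F N ((θ.pinX3 F N lam8 lam12 lam13).view₁₃B10YZW F N Mstar ops ζ lamW) P)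
    (h05 : ∀ P : B12.RunParams, B8LeafR θ.D (θ.L : ℝ) lam8.C₂ lam8.B₁' lam8.inp.B₀' lam8.B₁ lam8.B₂ lam8.c₁ lam8.inp lam8.B₀β
      (B8Lemma1NonAbelian.blockPairNA θ.D θ.L θ.𝔸) (fun j : IdxB8SubB θ.toStage3Params => famB8OfRecordSubB θ.toStage3Params lam8.β lam8.len j)
      lam8.lan lam8.cub (fun j => lam8.toAxial j.1))
    (h06 : B9LeafX (Y9OfRecord N θ.toStage3Params Mstar ops)) (h07 : B11Leaf (Z11OfRecord F N ζ)) (h08 : PrintedUV3V N θ.L)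
    (h09 : ∀ P : B12.RunParams, B12Sec2to5.Lemma4Printed (F12OfRecord₁₂ F N θ.toStage12Params lam12 P) (lam12 P).consts)
    (h09T : ∀ P : B12.RunParams, (leavesP w P).smallCouplings → (leavesP w P).smallFieldInductive) (h10 : ∀ P : B12.RunParams, B13LeafOfRecord θ.toStage3Params (lam13 P))
    (h11 : ∀ P : B12.RunParams, (leavesP w P).b7 → (leavesP w P).b8 → (leavesP w P).b9 → (leavesP w P).b10 → (leavesP w P).b11 →
      (leavesP w P).smallCouplings → (leavesP w P).smallFieldInductive → (leavesP w P).flowControl →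
        ∀ k, k < P.K → SLaw₁₃ F N θ P k → TLaw₁₃ F N θ P k)
    (h12 : ∀ P : B12.RunParams, B15Leaf (WOfRecord₁₃ F N θ lamW P)) (hR : ∀ (P : B12.RunParams) (k : ℕ), k < P.K → TLaw₁₃ F N θ P k → SLaw₁₃ F N θ P (k + 1))
    (hUV : ∀ P : B12.RunParams, (genFlow (betaOfRecord₁₃ F N θ) P.g0).InInterval w.γ P.K → ∀ k, k ≤ P.K → SLaw₁₃ F N θ P k →
      ∀ U : GaugeField (F.P P.K) k (SU N),
        chiβOfRecord₁₃ F N θ P.K (gOfRecord₁₃ F N θ P) k U *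
              Real.exp (-(1 / (gOfRecord₁₃ F N θ P k) ^ 2 * wilsonBGOfRecord F N θ.εbg P k U)
                - w.em (gOfRecord₁₃ F N θ P k) * (Fintype.card (Site (F.P P.K) k) : ℝ)) ≤ densOfRecord₁₃ F N θ P k U ∧
        densOfRecord₁₃ F N θ P k U ≤ Real.exp (w.ep (gOfRecord₁₃ F N θ P k) * (Fintype.card (Site (F.P P.K) k) : ℝ)))
    (hlo : BetaLowerH w.b w.γ (datumOfRecord₁₃ F N θ hP).βfun) (hhi : BetaUpperH w.βup w.γ (datumOfRecord₁₃ F N θ hP).βfun) :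
    ∃ (θ' : Stage13Params F N) (h' : θ'.Provisos₁₃ F N), (θ'.ZtUnity F N ∧ θ'.SlotsNondegenerate₁₃ F N) ∧ θ'.Admissible F N ∧
      B16.EndStatementBPrinted (datumOfRecord₁₃ F N θ' h').C ∧
      ∃ γ₁ : ℝ, 0 < γ₁ ∧ ∀ γ : ℝ, 0 < γ → γ ≤ γ₁ → ∃ P : B12.RunParams, 1 ≤ P.K ∧ ((datumOfRecord₁₃ F N θ' h').C P).flow.InInterval γ P.K :=
  N24_stabilityBR13e_thetaShape16_rebindX_fourPin_pointed θ hP hθ hU (XPinned₁₃ F N θ lam8 lam12 lam13) Mstar ops ζ lamW w hC hγ hL hup (fun P => (socket05_pinX3_iff F N θ lam8 lam12 lam13 P).2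
    (h05 P)) h06 h07 h08 (fun P => (socket09_pinX3_iff F N θ lam8 lam12 lam13 P).2 (h09 P)) h09T (fun P _ _ _ _ => (socket10_pinX3_iff F N θ lam8 lam12 lam13 P).2 (h10 P)) h11 h12 hR hUV hlo hhi

/-- **THE ∃-BODY OF `BetaWindowAtSomeRecord13` WITNESSED BY `(θ, hP, w)` OVER THE FOUR-PIN VIEW OF THE X-PINNED PARAMETER, N05 ∕ N09 ∕ N10 ← THEIR LEAVES OF RECORD** (module 43 §2
`N24_betaWindowAtSomeRecord₁₃_of_rebindX_fourPin_pointed_of_boxH` at `X' := XPinned₁₃ F N θ lam8 lam12 lam13`).  COMPOSITE; NOT the stub. [cite: Balaban1989LargeFieldII, Thm 1 p.355, (0.1) pp.355–356, p.391; Balaban1988Convergent, (3.16)–(3.22) pp.268–269; Balaban1987RG1, Thm 3 p.264, (0.17)–(0.21) pp.255–256 and (1.22) p.264, (2.9) p.266; Balaban1985RegularSpaces, Thm 2 p.83; Balaban1987RG1, Lemma 4 p.280; Balaban1988RG2Cluster, Lemmas 1–3 pp.9–20; Balaban1985UV3, Thm 1 p.257 (bookkeeping + elementary window)] -/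
theorem betaWindowAtSomeRecord₁₃_pinX3_of_leaves_of_boxH (θ : Stage13Params F N) (hP : θ.Provisos₁₃ F N) (hθ : θ.Admissible F N) (hU : θ.ZtUnity F N ∧ θ.SlotsNondegenerate₁₃ F N)
    (lam8 : ResidB8 θ.toStage3Params) (lam12 : ResidB12 F N θ.τ9.M) (lam13 : B12.RunParams → ResidB13 θ.toStage3Params) (Mstar : ℕ) (ops : OpsY N θ.toStage3Params Mstar) (ζ : ResidZ F N)
    (lamW : ResidW F N) (w : WorldP) (hC : w.C = (datumOfRecord₁₃ F N θ hP).C) (hγ : 0 < w.γ ∧ w.γ ≤ θ.γ) (hL : w.L = (θ.L : ℝ))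
    (hup : ∀ P, w.up P = upOfRecord₅C F N ((θ.pinX3 F N lam8 lam12 lam13).view₁₃B10YZW F N Mstar ops ζ lamW) P)
    (h05 : ∀ P : B12.RunParams, B8LeafR θ.D (θ.L : ℝ) lam8.C₂ lam8.B₁' lam8.inp.B₀' lam8.B₁ lam8.B₂ lam8.c₁ lam8.inp lam8.B₀β
      (B8Lemma1NonAbelian.blockPairNA θ.D θ.L θ.𝔸) (fun j : IdxB8SubB θ.toStage3Params => famB8OfRecordSubB θ.toStage3Params lam8.β lam8.len j)
      lam8.lan lam8.cub (fun j => lam8.toAxial j.1))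
    (h06 : B9LeafX (Y9OfRecord N θ.toStage3Params Mstar ops)) (h07 : B11Leaf (Z11OfRecord F N ζ)) (h08 : PrintedUV3V N θ.L)
    (h09 : ∀ P : B12.RunParams, B12Sec2to5.Lemma4Printed (F12OfRecord₁₂ F N θ.toStage12Params lam12 P) (lam12 P).consts)
    (h09T : ∀ P : B12.RunParams, (leavesP w P).smallCouplings → (leavesP w P).smallFieldInductive) (h10 : ∀ P : B12.RunParams, B13LeafOfRecord θ.toStage3Params (lam13 P))
    (h11 : ∀ P : B12.RunParams, (leavesP w P).b7 → (leavesP w P).b8 → (leavesP w P).b9 → (leavesP w P).b10 → (leavesP w P).b11 →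
      (leavesP w P).smallCouplings → (leavesP w P).smallFieldInductive → (leavesP w P).flowControl →
        ∀ k, k < P.K → SLaw₁₃ F N θ P k → TLaw₁₃ F N θ P k)
    (h12 : ∀ P : B12.RunParams, B15Leaf (WOfRecord₁₃ F N θ lamW P)) (hR : ∀ (P : B12.RunParams) (k : ℕ), k < P.K → TLaw₁₃ F N θ P k → SLaw₁₃ F N θ P (k + 1))
    (hUV : ∀ P : B12.RunParams, (genFlow (betaOfRecord₁₃ F N θ) P.g0).InInterval w.γ P.K → ∀ k, k ≤ P.K → SLaw₁₃ F N θ P k →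
      ∀ U : GaugeField (F.P P.K) k (SU N),
        chiβOfRecord₁₃ F N θ P.K (gOfRecord₁₃ F N θ P) k U *
              Real.exp (-(1 / (gOfRecord₁₃ F N θ P k) ^ 2 * wilsonBGOfRecord F N θ.εbg P k U)
                - w.em (gOfRecord₁₃ F N θ P k) * (Fintype.card (Site (F.P P.K) k) : ℝ)) ≤ densOfRecord₁₃ F N θ P k U ∧
        densOfRecord₁₃ F N θ P k U ≤ Real.exp (w.ep (gOfRecord₁₃ F N θ P k) * (Fintype.card (Site (F.P P.K) k) : ℝ)))
    (hlo : BetaLowerH w.b w.γ (datumOfRecord₁₃ F N θ hP).βfun) (hhi : BetaUpperH w.βup w.γ (datumOfRecord₁₃ F N θ hP).βfun) :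
    ∃ (θ' : Stage13Params F N) (h' : θ'.Provisos₁₃ F N) (w' : WorldP), (θ'.ZtUnity F N ∧ θ'.SlotsNondegenerate₁₃ F N) ∧ θ'.Admissible F N ∧
      IsRecordOfRecord₁₃C F N (datumOfRecord₁₃ F N θ' h') w' ∧ (∀ P : B12.RunParams, Nodes (leavesP w' P)) ∧
      BetaBoundsInInterval w'.C.toB12 w'.γ w'.b w'.βup ∧
      ∃ γ₁ : ℝ, 0 < γ₁ ∧ ∀ γ : ℝ, 0 < γ → γ ≤ γ₁ → ∃ P : B12.RunParams, 1 ≤ P.K ∧ ((datumOfRecord₁₃ F N θ' h').C P).flow.InInterval γ P.K :=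
  N24_betaWindowAtSomeRecord₁₃_of_rebindX_fourPin_pointed_of_boxH θ hP hθ hU (XPinned₁₃ F N θ lam8 lam12 lam13) Mstar ops ζ lamW w hC hγ hL hup (fun P => (socket05_pinX3_iff F N θ lam8 lam12
    lam13 P).2 (h05 P)) h06 h07 h08 (fun P => (socket09_pinX3_iff F N θ lam8 lam12 lam13 P).2 (h09 P)) h09T (fun P _ _ _ _ => (socket10_pinX3_iff F N θ lam8 lam12 lam13 P).2 (h10 P)) h11 h12 hR
    hUV hlo hhi

/-! ## §2. At node00-def-K0a's Stage-13 witness families: the same closers at `θL.pinX3 lam8 lam12 lam13` -/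

/-- **★ ITEM K1‴'s θ-KEYED CONSEQUENT WITNESSED BY K0a's ALL-NUMERICS MEMBER `(theta13LiveOfNumerics F N n ε₂₉ ζ Rz Zt, hP)`, CHILDREN OVER THE FOUR-PIN VIEW OF ITS X-PINNED
PARAMETER `θL.pinX3 lam8 lam12 lam13`, N05 ∕ N09 ∕ N10 ← THEIR LEAVES OF RECORD** (module 44 §1 at `X' := XPinned₁₃ F N θL lam8 lam12 lam13`; `Admissible`, `SlotsNondegenerate₁₃`, (R₁₃) are
THEOREMS there — K0a FILE 9, dag-n11-e (A′) —, `hZ`, `hP`, `n.Pos`, `0 < ε₂₉`, the three signs of `n` displayed exactly as in module 44).  COMPOSITE; NOT the stub. [cite: Balaban1989LargeFieldII, Thm 1 p.355, (0.1) pp.355–356, p.391; Balaban1988Convergent, p.244, Thm 2 p.263, (2.4) p.255, (2.28) p.259, (3.16)–(3.22) pp.268–269; Balaban1989LargeFieldI, (0.2)–(0.4) p.176; Balaban1987RG1, (0.21) p.256, (2.9) p.266, Thm 3 p.264, (1.22) p.264, Lemma 4 p.280; Balaban1985RegularSpaces, Thm 2 p.83; Balaban1988RG2Cluster, Lemmas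 1–3 pp.9–20; Balaban1985UV3, Thm 1 p.257 (bookkeeping + elementary window)] -/
theorem stabilityBR13e_thetaShape16_pinX3_of_leaves_theta13LiveOfNumerics {n : Stage12Numerics} {ε₂₉ : ℝ} (hn : n.Pos) (hε' : 0 < ε₂₉) (hκ : 0 ≤ n.s2.lf.κ) (hE₀ : 0 ≤ n.s2.lf.E₀)
    (hB₀ : 0 ≤ n.s2.lf.B₀) (ζ : ZetaOfRecord F N n.ν n.τ9.M) (Rz : (K : ℕ) → Sect2.Residual (F.P K) (MatA N)) (Zt : (K : ℕ) → TkResidualW F N (FluctV N) K)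
    (hP : (theta13LiveOfNumerics F N n ε₂₉ ζ Rz Zt).Provisos₁₃ F N) (hZ : (theta13LiveOfNumerics F N n ε₂₉ ζ Rz Zt).ZtUnity F N)
    (lam8 : ResidB8 (theta13LiveOfNumerics F N n ε₂₉ ζ Rz Zt).toStage3Params) (lam12 : ResidB12 F N (theta13LiveOfNumerics F N n ε₂₉ ζ Rz Zt).τ9.M) (lam13 : B12.RunParams → ResidB13 (theta13LiveOfNumerics F N n ε₂₉ ζ Rz Zt).toStage3Params)
    (Mstar : ℕ) (ops : OpsY N (theta13LiveOfNumerics F N n ε₂₉ ζ Rz Zt).toStage3Params Mstar) (ζ9 : ResidZ F N) (lamW : ResidW F N) (w : WorldP)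
    (hC : w.C = (datumOfRecord₁₃ F N (theta13LiveOfNumerics F N n ε₂₉ ζ Rz Zt) hP).C) (hγ : 0 < w.γ ∧ w.γ ≤ (theta13LiveOfNumerics F N n ε₂₉ ζ Rz Zt).γ)
    (hL : w.L = ((theta13LiveOfNumerics F N n ε₂₉ ζ Rz Zt).L : ℝ))
    (hup : ∀ P, w.up P = upOfRecord₅C F N (((theta13LiveOfNumerics F N n ε₂₉ ζ Rz Zt).pinX3 F N lam8 lam12 lam13).view₁₃B10YZW F N Mstar ops ζ9 lamW) P)
    (h05 : ∀ P : B12.RunParams, B8LeafR (theta13LiveOfNumerics F N n ε₂₉ ζ Rz Zt).D ((theta13LiveOfNumerics F N n ε₂₉ ζ Rz Zt).L : ℝ) lam8.C₂ lam8.B₁' lam8.inp.B₀' lam8.B₁ lam8.B₂ lam8.c₁ lam8.inp lam8.B₀β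
      (B8Lemma1NonAbelian.blockPairNA (theta13LiveOfNumerics F N n ε₂₉ ζ Rz Zt).D (theta13LiveOfNumerics F N n ε₂₉ ζ Rz Zt).L (theta13LiveOfNumerics F N n ε₂₉ ζ Rz Zt).𝔸) (fun j : IdxB8SubB (theta13LiveOfNumerics F N n ε₂₉ ζ Rz Zt).toStage3Params => famB8OfRecordSubB (theta13LiveOfNumerics F N n ε₂₉ ζ Rz Zt).toStage3Params lam8.β lam8.len j)
      lam8.lan lam8.cub (fun j => lam8.toAxial j.1))
    (h06 : B9LeafX (Y9OfRecord N (theta13LiveOfNumerics F N n ε₂₉ ζ Rz Zt).toStage3Params Mstar ops)) (h07 : B11Leaf (Z11OfRecord F N ζ9))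
    (h08 : PrintedUV3V N (theta13LiveOfNumerics F N n ε₂₉ ζ Rz Zt).L)
    (h09 : ∀ P : B12.RunParams, B12Sec2to5.Lemma4Printed (F12OfRecord₁₂ F N (theta13LiveOfNumerics F N n ε₂₉ ζ Rz Zt).toStage12Params lam12 P) (lam12 P).consts)
    (h09T : ∀ P : B12.RunParams, (leavesP w P).smallCouplings → (leavesP w P).smallFieldInductive)
    (h10 : ∀ P : B12.RunParams, B13LeafOfRecord (theta13LiveOfNumerics F N n ε₂₉ ζ Rz Zt).toStage3Params (lam13 P))
    (h11 : ∀ P : B12.RunParams, (leavesP w P).b7 → (leavesP w P).b8 → (leavesP w P).b9 → (leavesP w P).b10 → (leavesP w P).b11 →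
      (leavesP w P).smallCouplings → (leavesP w P).smallFieldInductive → (leavesP w P).flowControl →
        ∀ k, k < P.K → SLaw₁₃ F N (theta13LiveOfNumerics F N n ε₂₉ ζ Rz Zt) P k → TLaw₁₃ F N (theta13LiveOfNumerics F N n ε₂₉ ζ Rz Zt) P k)
    (h12 : ∀ P : B12.RunParams, B15Leaf (WOfRecord₁₃ F N (theta13LiveOfNumerics F N n ε₂₉ ζ Rz Zt) lamW P))
    (hUV : ∀ P : B12.RunParams, (genFlow (betaOfRecord₁₃ F N (theta13LiveOfNumerics F N n ε₂₉ ζ Rz Zt)) P.g0).InInterval w.γ P.K → ∀ k, k ≤ P.K → SLaw₁₃ F N (theta13LiveOfNumerics F N n ε₂₉ ζ Rz Zt) P k →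
      ∀ U : GaugeField (F.P P.K) k (SU N),
        chiβOfRecord₁₃ F N (theta13LiveOfNumerics F N n ε₂₉ ζ Rz Zt) P.K (gOfRecord₁₃ F N (theta13LiveOfNumerics F N n ε₂₉ ζ Rz Zt) P) k U *
              Real.exp (-(1 / (gOfRecord₁₃ F N (theta13LiveOfNumerics F N n ε₂₉ ζ Rz Zt) P k) ^ 2 * wilsonBGOfRecord F N (theta13LiveOfNumerics F N n ε₂₉ ζ Rz Zt).εbg P k U)
                - w.em (gOfRecord₁₃ F N (theta13LiveOfNumerics F N n ε₂₉ ζ Rz Zt) P k) * (Fintype.card (Site (F.P P.K) k) : ℝ)) ≤ densOfRecord₁₃ F N (theta13LiveOfNumerics F N n ε₂₉ ζ Rz Zt) P k U ∧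
        densOfRecord₁₃ F N (theta13LiveOfNumerics F N n ε₂₉ ζ Rz Zt) P k U ≤ Real.exp (w.ep (gOfRecord₁₃ F N (theta13LiveOfNumerics F N n ε₂₉ ζ Rz Zt) P k) * (Fintype.card (Site (F.P P.K) k) : ℝ)))
    (hlo : BetaLowerH w.b w.γ (datumOfRecord₁₃ F N (theta13LiveOfNumerics F N n ε₂₉ ζ Rz Zt) hP).βfun)
    (hhi : BetaUpperH w.βup w.γ (datumOfRecord₁₃ F N (theta13LiveOfNumerics F N n ε₂₉ ζ Rz Zt) hP).βfun) :
    ∃ (θ' : Stage13Params F N) (h' : θ'.Provisos₁₃ F N), (θ'.ZtUnity F N ∧ θ'.SlotsNondegenerate₁₃ F N) ∧ θ'.Admissible F N ∧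
      B16.EndStatementBPrinted (datumOfRecord₁₃ F N θ' h').C ∧
      ∃ γ₁ : ℝ, 0 < γ₁ ∧ ∀ γ : ℝ, 0 < γ → γ ≤ γ₁ → ∃ P : B12.RunParams, 1 ≤ P.K ∧ ((datumOfRecord₁₃ F N θ' h').C P).flow.InInterval γ P.K :=
  N24_stabilityBR13e_thetaShape16_rebindX_fourPin_pointed_theta13LiveOfNumerics hn hε' hκ hE₀ hB₀ ζ Rz Zt hP hZ (XPinned₁₃ F N (theta13LiveOfNumerics F N n ε₂₉ ζ Rz Zt) lam8 lam12 lam13) Mstar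
    ops ζ9 lamW w hC hγ hL hup (fun P => (socket05_pinX3_iff F N (theta13LiveOfNumerics F N n ε₂₉ ζ Rz Zt) lam8 lam12 lam13 P).2 (h05 P)) h06 h07 h08 (fun P => (socket09_pinX3_iff F N
    (theta13LiveOfNumerics F N n ε₂₉ ζ Rz Zt) lam8 lam12 lam13 P).2 (h09 P)) h09T (fun P _ _ _ _ => (socket10_pinX3_iff F N (theta13LiveOfNumerics F N n ε₂₉ ζ Rz Zt) lam8 lam12 lam13 P).2 (h10
    P)) h11 h12 hUV hlo hhi

/-- **THE ∃-BODY OF `BetaWindowAtSomeRecord13` WITNESSED BY `(theta13LiveOfNumerics F N n ε₂₉ ζ Rz Zt, hP, w)`, children over the four-pin view of its X-pinned parameter, N05 ∕ N09 ∕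
N10 ← their leaves of record** (module 44 §1 at `X' := XPinned₁₃ F N θL lam8 lam12 lam13`).  COMPOSITE; NOT the stub. [cite: Balaban1989LargeFieldII, Thm 1 p.355, (0.1) pp.355–356, p.391; Balaban1988Convergent, p.244, Thm 2 p.263, (2.4) p.255, (2.28) p.259, (3.16)–(3.22) pp.268–269; Balaban1989LargeFieldI, (0.2)–(0.4) p.176; Balaban1987RG1, (0.21) p.256, (2.9) p.266, Thm 3 p.264, (1.22) p.264, Lemma 4 p.280; Balaban1985RegularSpaces, Thm 2 p.83; Balaban1988RG2Cluster, Lemmas 1–3 pp.9–20; Balaban1985UV3, Thm 1 p.257 (bookkeeping + elementary window)] -/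
theorem betaWindowAtSomeRecord₁₃_pinX3_of_leaves_theta13LiveOfNumerics_of_boxH {n : Stage12Numerics} {ε₂₉ : ℝ} (hn : n.Pos) (hε' : 0 < ε₂₉) (hκ : 0 ≤ n.s2.lf.κ) (hE₀ : 0 ≤ n.s2.lf.E₀)
    (hB₀ : 0 ≤ n.s2.lf.B₀) (ζ : ZetaOfRecord F N n.ν n.τ9.M) (Rz : (K : ℕ) → Sect2.Residual (F.P K) (MatA N)) (Zt : (K : ℕ) → TkResidualW F N (FluctV N) K)
    (hP : (theta13LiveOfNumerics F N n ε₂₉ ζ Rz Zt).Provisos₁₃ F N) (hZ : (theta13LiveOfNumerics F N n ε₂₉ ζ Rz Zt).ZtUnity F N)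
    (lam8 : ResidB8 (theta13LiveOfNumerics F N n ε₂₉ ζ Rz Zt).toStage3Params) (lam12 : ResidB12 F N (theta13LiveOfNumerics F N n ε₂₉ ζ Rz Zt).τ9.M) (lam13 : B12.RunParams → ResidB13 (theta13LiveOfNumerics F N n ε₂₉ ζ Rz Zt).toStage3Params)
    (Mstar : ℕ) (ops : OpsY N (theta13LiveOfNumerics F N n ε₂₉ ζ Rz Zt).toStage3Params Mstar) (ζ9 : ResidZ F N) (lamW : ResidW F N) (w : WorldP)
    (hC : w.C = (datumOfRecord₁₃ F N (theta13LiveOfNumerics F N n ε₂₉ ζ Rz Zt) hP).C) (hγ : 0 < w.γ ∧ w.γ ≤ (theta13LiveOfNumerics F N n ε₂₉ ζ Rz Zt).γ)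
    (hL : w.L = ((theta13LiveOfNumerics F N n ε₂₉ ζ Rz Zt).L : ℝ))
    (hup : ∀ P, w.up P = upOfRecord₅C F N (((theta13LiveOfNumerics F N n ε₂₉ ζ Rz Zt).pinX3 F N lam8 lam12 lam13).view₁₃B10YZW F N Mstar ops ζ9 lamW) P)
    (h05 : ∀ P : B12.RunParams, B8LeafR (theta13LiveOfNumerics F N n ε₂₉ ζ Rz Zt).D ((theta13LiveOfNumerics F N n ε₂₉ ζ Rz Zt).L : ℝ) lam8.C₂ lam8.B₁' lam8.inp.B₀' lam8.B₁ lam8.B₂ lam8.c₁ lam8.inp lam8.B₀β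
      (B8Lemma1NonAbelian.blockPairNA (theta13LiveOfNumerics F N n ε₂₉ ζ Rz Zt).D (theta13LiveOfNumerics F N n ε₂₉ ζ Rz Zt).L (theta13LiveOfNumerics F N n ε₂₉ ζ Rz Zt).𝔸) (fun j : IdxB8SubB (theta13LiveOfNumerics F N n ε₂₉ ζ Rz Zt).toStage3Params => famB8OfRecordSubB (theta13LiveOfNumerics F N n ε₂₉ ζ Rz Zt).toStage3Params lam8.β lam8.len j)
      lam8.lan lam8.cub (fun j => lam8.toAxial j.1))
    (h06 : B9LeafX (Y9OfRecord N (theta13LiveOfNumerics F N n ε₂₉ ζ Rz Zt).toStage3Params Mstar ops)) (h07 : B11Leaf (Z11OfRecord F N ζ9))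
    (h08 : PrintedUV3V N (theta13LiveOfNumerics F N n ε₂₉ ζ Rz Zt).L)
    (h09 : ∀ P : B12.RunParams, B12Sec2to5.Lemma4Printed (F12OfRecord₁₂ F N (theta13LiveOfNumerics F N n ε₂₉ ζ Rz Zt).toStage12Params lam12 P) (lam12 P).consts)
    (h09T : ∀ P : B12.RunParams, (leavesP w P).smallCouplings → (leavesP w P).smallFieldInductive)
    (h10 : ∀ P : B12.RunParams, B13LeafOfRecord (theta13LiveOfNumerics F N n ε₂₉ ζ Rz Zt).toStage3Params (lam13 P))
    (h11 : ∀ P : B12.RunParams, (leavesP w P).b7 → (leavesP w P).b8 → (leavesP w P).b9 → (leavesP w P).b10 → (leavesP w P).b11 →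
      (leavesP w P).smallCouplings → (leavesP w P).smallFieldInductive → (leavesP w P).flowControl →
        ∀ k, k < P.K → SLaw₁₃ F N (theta13LiveOfNumerics F N n ε₂₉ ζ Rz Zt) P k → TLaw₁₃ F N (theta13LiveOfNumerics F N n ε₂₉ ζ Rz Zt) P k)
    (h12 : ∀ P : B12.RunParams, B15Leaf (WOfRecord₁₃ F N (theta13LiveOfNumerics F N n ε₂₉ ζ Rz Zt) lamW P))
    (hUV : ∀ P : B12.RunParams, (genFlow (betaOfRecord₁₃ F N (theta13LiveOfNumerics F N n ε₂₉ ζ Rz Zt)) P.g0).InInterval w.γ P.K → ∀ k, k ≤ P.K → SLaw₁₃ F N (theta13LiveOfNumerics F N n ε₂₉ ζ Rz Zt) P k →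
      ∀ U : GaugeField (F.P P.K) k (SU N),
        chiβOfRecord₁₃ F N (theta13LiveOfNumerics F N n ε₂₉ ζ Rz Zt) P.K (gOfRecord₁₃ F N (theta13LiveOfNumerics F N n ε₂₉ ζ Rz Zt) P) k U *
              Real.exp (-(1 / (gOfRecord₁₃ F N (theta13LiveOfNumerics F N n ε₂₉ ζ Rz Zt) P k) ^ 2 * wilsonBGOfRecord F N (theta13LiveOfNumerics F N n ε₂₉ ζ Rz Zt).εbg P k U)
                - w.em (gOfRecord₁₃ F N (theta13LiveOfNumerics F N n ε₂₉ ζ Rz Zt) P k) * (Fintype.card (Site (F.P P.K) k) : ℝ)) ≤ densOfRecord₁₃ F N (theta13LiveOfNumerics F N n ε₂₉ ζ Rz Zt) P k U ∧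
        densOfRecord₁₃ F N (theta13LiveOfNumerics F N n ε₂₉ ζ Rz Zt) P k U ≤ Real.exp (w.ep (gOfRecord₁₃ F N (theta13LiveOfNumerics F N n ε₂₉ ζ Rz Zt) P k) * (Fintype.card (Site (F.P P.K) k) : ℝ)))
    (hlo : BetaLowerH w.b w.γ (datumOfRecord₁₃ F N (theta13LiveOfNumerics F N n ε₂₉ ζ Rz Zt) hP).βfun)
    (hhi : BetaUpperH w.βup w.γ (datumOfRecord₁₃ F N (theta13LiveOfNumerics F N n ε₂₉ ζ Rz Zt) hP).βfun) :
    ∃ (θ' : Stage13Params F N) (h' : θ'.Provisos₁₃ F N) (w' : WorldP), (θ'.ZtUnity F N ∧ θ'.SlotsNondegenerate₁₃ F N) ∧ θ'.Admissible F N ∧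
      IsRecordOfRecord₁₃C F N (datumOfRecord₁₃ F N θ' h') w' ∧ (∀ P : B12.RunParams, Nodes (leavesP w' P)) ∧
      BetaBoundsInInterval w'.C.toB12 w'.γ w'.b w'.βup ∧
      ∃ γ₁ : ℝ, 0 < γ₁ ∧ ∀ γ : ℝ, 0 < γ → γ ≤ γ₁ → ∃ P : B12.RunParams, 1 ≤ P.K ∧ ((datumOfRecord₁₃ F N θ' h').C P).flow.InInterval γ P.K :=
  N24_betaWindowAtSomeRecord₁₃_of_rebindX_fourPin_pointed_theta13LiveOfNumerics_of_boxH hn hε' hκ hE₀ hB₀ ζ Rz Zt hP hZ (XPinned₁₃ F N (theta13LiveOfNumerics F N n ε₂₉ ζ Rz Zt) lam8 lam12 lam13)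
    Mstar ops ζ9 lamW w hC hγ hL hup (fun P => (socket05_pinX3_iff F N (theta13LiveOfNumerics F N n ε₂₉ ζ Rz Zt) lam8 lam12 lam13 P).2 (h05 P)) h06 h07 h08 (fun P => (socket09_pinX3_iff F N
    (theta13LiveOfNumerics F N n ε₂₉ ζ Rz Zt) lam8 lam12 lam13 P).2 (h09 P)) h09T (fun P _ _ _ _ => (socket10_pinX3_iff F N (theta13LiveOfNumerics F N n ε₂₉ ζ Rz Zt) lam8 lam12 lam13 P).2 (h10
    P)) h11 h12 hUV hlo hhi

/-- **★ ITEM K1‴'s θ-KEYED CONSEQUENT WITNESSED BY K0a's OPEN-LETTER MEMBER `(theta13LiveOfFamily₂ F N ε₀ ε₂₉ ζ Rz Zt, hP)`** (the witness of record `theta13LiveOfRecord F N` is its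
`(1, ⅛)` member, K0a `theta13LiveOfRecord_eq_family₂`), **CHILDREN OVER THE FOUR-PIN VIEW OF ITS X-PINNED PARAMETER, N05 ∕ N09 ∕ N10 ← THEIR LEAVES OF RECORD** (module 44 §2 at
`X' := XPinned₁₃ F N θ lam8 lam12 lam13`; `hε hε' hP hZ` displayed as there).  COMPOSITE; NOT the stub. [cite: Balaban1989LargeFieldII, Thm 1 p.355, (0.1) pp.355–356, p.391; Balaban1988Convergent, p.244, Thm 2 p.263, (2.4) p.255, (2.28) p.259, (3.16)–(3.22) pp.268–269; Balaban1989LargeFieldI, (0.2)–(0.4) p.176; Balaban1987RG1, (0.21) p.256, (2.9) p.266, Thm 3 p.264, (1.22) p.264, Lemma 4 p.280; Balaban1985RegularSpaces, Thm 2 p.83; Balaban1988RG2Cluster, Lemmas 1–3 pp.9–20; Balaban1985UV3, Thm 1 p.257 (bookkeeping + elementary window)] -/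
theorem stabilityBR13e_thetaShape16_pinX3_of_leaves_theta13LiveOfFamily₂ {ε₀ ε₂₉ : ℝ} (hε : 0 < ε₀) (hε' : 0 < ε₂₉) (ζ : ZetaOfRecord F N (numerics7OfFamily ε₀) 1)
    (Rz : (K : ℕ) → Sect2.Residual (F.P K) (MatA N)) (Zt : (K : ℕ) → TkResidualW F N (FluctV N) K) (hP : (theta13LiveOfFamily₂ F N ε₀ ε₂₉ ζ Rz Zt).Provisos₁₃ F N)
    (hZ : (theta13LiveOfFamily₂ F N ε₀ ε₂₉ ζ Rz Zt).ZtUnity F N)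
    (lam8 : ResidB8 (theta13LiveOfFamily₂ F N ε₀ ε₂₉ ζ Rz Zt).toStage3Params) (lam12 : ResidB12 F N (theta13LiveOfFamily₂ F N ε₀ ε₂₉ ζ Rz Zt).τ9.M) (lam13 : B12.RunParams → ResidB13 (theta13LiveOfFamily₂ F N ε₀ ε₂₉ ζ Rz Zt).toStage3Params)
    (Mstar : ℕ) (ops : OpsY N (theta13LiveOfFamily₂ F N ε₀ ε₂₉ ζ Rz Zt).toStage3Params Mstar) (ζ9 : ResidZ F N) (lamW : ResidW F N) (w : WorldP)
    (hC : w.C = (datumOfRecord₁₃ F N (theta13LiveOfFamily₂ F N ε₀ ε₂₉ ζ Rz Zt) hP).C) (hγ : 0 < w.γ ∧ w.γ ≤ (theta13LiveOfFamily₂ F N ε₀ ε₂₉ ζ Rz Zt).γ)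
    (hL : w.L = ((theta13LiveOfFamily₂ F N ε₀ ε₂₉ ζ Rz Zt).L : ℝ))
    (hup : ∀ P, w.up P = upOfRecord₅C F N (((theta13LiveOfFamily₂ F N ε₀ ε₂₉ ζ Rz Zt).pinX3 F N lam8 lam12 lam13).view₁₃B10YZW F N Mstar ops ζ9 lamW) P)
    (h05 : ∀ P : B12.RunParams, B8LeafR (theta13LiveOfFamily₂ F N ε₀ ε₂₉ ζ Rz Zt).D ((theta13LiveOfFamily₂ F N ε₀ ε₂₉ ζ Rz Zt).L : ℝ) lam8.C₂ lam8.B₁' lam8.inp.B₀' lam8.B₁ lam8.B₂ lam8.c₁ lam8.inp lam8.B₀β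
      (B8Lemma1NonAbelian.blockPairNA (theta13LiveOfFamily₂ F N ε₀ ε₂₉ ζ Rz Zt).D (theta13LiveOfFamily₂ F N ε₀ ε₂₉ ζ Rz Zt).L (theta13LiveOfFamily₂ F N ε₀ ε₂₉ ζ Rz Zt).𝔸) (fun j : IdxB8SubB (theta13LiveOfFamily₂ F N ε₀ ε₂₉ ζ Rz Zt).toStage3Params => famB8OfRecordSubB (theta13LiveOfFamily₂ F N ε₀ ε₂₉ ζ Rz Zt).toStage3Params lam8.β lam8.len j)
      lam8.lan lam8.cub (fun j => lam8.toAxial j.1))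
    (h06 : B9LeafX (Y9OfRecord N (theta13LiveOfFamily₂ F N ε₀ ε₂₉ ζ Rz Zt).toStage3Params Mstar ops)) (h07 : B11Leaf (Z11OfRecord F N ζ9))
    (h08 : PrintedUV3V N (theta13LiveOfFamily₂ F N ε₀ ε₂₉ ζ Rz Zt).L)
    (h09 : ∀ P : B12.RunParams, B12Sec2to5.Lemma4Printed (F12OfRecord₁₂ F N (theta13LiveOfFamily₂ F N ε₀ ε₂₉ ζ Rz Zt).toStage12Params lam12 P) (lam12 P).consts)
    (h09T : ∀ P : B12.RunParams, (leavesP w P).smallCouplings → (leavesP w P).smallFieldInductive)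
    (h10 : ∀ P : B12.RunParams, B13LeafOfRecord (theta13LiveOfFamily₂ F N ε₀ ε₂₉ ζ Rz Zt).toStage3Params (lam13 P))
    (h11 : ∀ P : B12.RunParams, (leavesP w P).b7 → (leavesP w P).b8 → (leavesP w P).b9 → (leavesP w P).b10 → (leavesP w P).b11 →
      (leavesP w P).smallCouplings → (leavesP w P).smallFieldInductive → (leavesP w P).flowControl →
        ∀ k, k < P.K → SLaw₁₃ F N (theta13LiveOfFamily₂ F N ε₀ ε₂₉ ζ Rz Zt) P k → TLaw₁₃ F N (theta13LiveOfFamily₂ F N ε₀ ε₂₉ ζ Rz Zt) P k)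
    (h12 : ∀ P : B12.RunParams, B15Leaf (WOfRecord₁₃ F N (theta13LiveOfFamily₂ F N ε₀ ε₂₉ ζ Rz Zt) lamW P))
    (hUV : ∀ P : B12.RunParams, (genFlow (betaOfRecord₁₃ F N (theta13LiveOfFamily₂ F N ε₀ ε₂₉ ζ Rz Zt)) P.g0).InInterval w.γ P.K → ∀ k, k ≤ P.K → SLaw₁₃ F N (theta13LiveOfFamily₂ F N ε₀ ε₂₉ ζ Rz Zt) P k →
      ∀ U : GaugeField (F.P P.K) k (SU N),
        chiβOfRecord₁₃ F N (theta13LiveOfFamily₂ F N ε₀ ε₂₉ ζ Rz Zt) P.K (gOfRecord₁₃ F N (theta13LiveOfFamily₂ F N ε₀ ε₂₉ ζ Rz Zt) P) k U *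
              Real.exp (-(1 / (gOfRecord₁₃ F N (theta13LiveOfFamily₂ F N ε₀ ε₂₉ ζ Rz Zt) P k) ^ 2 * wilsonBGOfRecord F N (theta13LiveOfFamily₂ F N ε₀ ε₂₉ ζ Rz Zt).εbg P k U)
                - w.em (gOfRecord₁₃ F N (theta13LiveOfFamily₂ F N ε₀ ε₂₉ ζ Rz Zt) P k) * (Fintype.card (Site (F.P P.K) k) : ℝ)) ≤ densOfRecord₁₃ F N (theta13LiveOfFamily₂ F N ε₀ ε₂₉ ζ Rz Zt) P k U ∧
        densOfRecord₁₃ F N (theta13LiveOfFamily₂ F N ε₀ ε₂₉ ζ Rz Zt) P k U ≤ Real.exp (w.ep (gOfRecord₁₃ F N (theta13LiveOfFamily₂ F N ε₀ ε₂₉ ζ Rz Zt) P k) * (Fintype.card (Site (F.P P.K) k) : ℝ)))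
    (hlo : BetaLowerH w.b w.γ (datumOfRecord₁₃ F N (theta13LiveOfFamily₂ F N ε₀ ε₂₉ ζ Rz Zt) hP).βfun)
    (hhi : BetaUpperH w.βup w.γ (datumOfRecord₁₃ F N (theta13LiveOfFamily₂ F N ε₀ ε₂₉ ζ Rz Zt) hP).βfun) :
    ∃ (θ' : Stage13Params F N) (h' : θ'.Provisos₁₃ F N), (θ'.ZtUnity F N ∧ θ'.SlotsNondegenerate₁₃ F N) ∧ θ'.Admissible F N ∧
      B16.EndStatementBPrinted (datumOfRecord₁₃ F N θ' h').C ∧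
      ∃ γ₁ : ℝ, 0 < γ₁ ∧ ∀ γ : ℝ, 0 < γ → γ ≤ γ₁ → ∃ P : B12.RunParams, 1 ≤ P.K ∧ ((datumOfRecord₁₃ F N θ' h').C P).flow.InInterval γ P.K :=
  N24_stabilityBR13e_thetaShape16_rebindX_fourPin_pointed_theta13LiveOfFamily₂ hε hε' ζ Rz Zt hP hZ (XPinned₁₃ F N (theta13LiveOfFamily₂ F N ε₀ ε₂₉ ζ Rz Zt) lam8 lam12 lam13) Mstar ops ζ9 lamW w
    hC hγ hL hup (fun P => (socket05_pinX3_iff F N (theta13LiveOfFamily₂ F N ε₀ ε₂₉ ζ Rz Zt) lam8 lam12 lam13 P).2 (h05 P)) h06 h07 h08 (fun P => (socket09_pinX3_iff F N (theta13LiveOfFamily₂ F N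
    ε₀ ε₂₉ ζ Rz Zt) lam8 lam12 lam13 P).2 (h09 P)) h09T (fun P _ _ _ _ => (socket10_pinX3_iff F N (theta13LiveOfFamily₂ F N ε₀ ε₂₉ ζ Rz Zt) lam8 lam12 lam13 P).2 (h10 P)) h11 h12 hUV hlo hhi

/-- **THE ∃-BODY OF `BetaWindowAtSomeRecord13` WITNESSED BY `(theta13LiveOfFamily₂ F N ε₀ ε₂₉ ζ Rz Zt, hP, w)`, children over the four-pin view of its X-pinned parameter, N05 ∕ N09 ∕
N10 ← their leaves of record** (module 44 §2 at `X' := XPinned₁₃ F N θ lam8 lam12 lam13`).  COMPOSITE; NOT the stub. [cite: Balaban1989LargeFieldII, Thm 1 p.355, (0.1) pp.355–356, p.391; Balaban1988Convergent, p.244, Thm 2 p.263, (2.4) p.255, (2.28) p.259, (3.16)–(3.22) pp.268–269; Balaban1989LargeFieldI, (0.2)–(0.4) p.176; Balaban1987RG1, (0.21) p.256, (2.9) p.266, Thm 3 p.264, (1.22) p.264, Lemma 4 p.280; Balaban1985RegularSpaces, Thm 2 p.83; Balaban1988RG2Cluster, Lemmas 1–3 pp.9–20; Balaban1985UV3, Thm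 1 p.257 (bookkeeping + elementary window)] -/
theorem betaWindowAtSomeRecord₁₃_pinX3_of_leaves_theta13LiveOfFamily₂_of_boxH {ε₀ ε₂₉ : ℝ} (hε : 0 < ε₀) (hε' : 0 < ε₂₉) (ζ : ZetaOfRecord F N (numerics7OfFamily ε₀) 1)
    (Rz : (K : ℕ) → Sect2.Residual (F.P K) (MatA N)) (Zt : (K : ℕ) → TkResidualW F N (FluctV N) K) (hP : (theta13LiveOfFamily₂ F N ε₀ ε₂₉ ζ Rz Zt).Provisos₁₃ F N)
    (hZ : (theta13LiveOfFamily₂ F N ε₀ ε₂₉ ζ Rz Zt).ZtUnity F N)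
    (lam8 : ResidB8 (theta13LiveOfFamily₂ F N ε₀ ε₂₉ ζ Rz Zt).toStage3Params) (lam12 : ResidB12 F N (theta13LiveOfFamily₂ F N ε₀ ε₂₉ ζ Rz Zt).τ9.M) (lam13 : B12.RunParams → ResidB13 (theta13LiveOfFamily₂ F N ε₀ ε₂₉ ζ Rz Zt).toStage3Params)
    (Mstar : ℕ) (ops : OpsY N (theta13LiveOfFamily₂ F N ε₀ ε₂₉ ζ Rz Zt).toStage3Params Mstar) (ζ9 : ResidZ F N) (lamW : ResidW F N) (w : WorldP)
    (hC : w.C = (datumOfRecord₁₃ F N (theta13LiveOfFamily₂ F N ε₀ ε₂₉ ζ Rz Zt) hP).C) (hγ : 0 < w.γ ∧ w.γ ≤ (theta13LiveOfFamily₂ F N ε₀ ε₂₉ ζ Rz Zt).γ)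
    (hL : w.L = ((theta13LiveOfFamily₂ F N ε₀ ε₂₉ ζ Rz Zt).L : ℝ))
    (hup : ∀ P, w.up P = upOfRecord₅C F N (((theta13LiveOfFamily₂ F N ε₀ ε₂₉ ζ Rz Zt).pinX3 F N lam8 lam12 lam13).view₁₃B10YZW F N Mstar ops ζ9 lamW) P)
    (h05 : ∀ P : B12.RunParams, B8LeafR (theta13LiveOfFamily₂ F N ε₀ ε₂₉ ζ Rz Zt).D ((theta13LiveOfFamily₂ F N ε₀ ε₂₉ ζ Rz Zt).L : ℝ) lam8.C₂ lam8.B₁' lam8.inp.B₀' lam8.B₁ lam8.B₂ lam8.c₁ lam8.inp lam8.B₀β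
      (B8Lemma1NonAbelian.blockPairNA (theta13LiveOfFamily₂ F N ε₀ ε₂₉ ζ Rz Zt).D (theta13LiveOfFamily₂ F N ε₀ ε₂₉ ζ Rz Zt).L (theta13LiveOfFamily₂ F N ε₀ ε₂₉ ζ Rz Zt).𝔸) (fun j : IdxB8SubB (theta13LiveOfFamily₂ F N ε₀ ε₂₉ ζ Rz Zt).toStage3Params => famB8OfRecordSubB (theta13LiveOfFamily₂ F N ε₀ ε₂₉ ζ Rz Zt).toStage3Params lam8.β lam8.len j)
      lam8.lan lam8.cub (fun j => lam8.toAxial j.1))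
    (h06 : B9LeafX (Y9OfRecord N (theta13LiveOfFamily₂ F N ε₀ ε₂₉ ζ Rz Zt).toStage3Params Mstar ops)) (h07 : B11Leaf (Z11OfRecord F N ζ9))
    (h08 : PrintedUV3V N (theta13LiveOfFamily₂ F N ε₀ ε₂₉ ζ Rz Zt).L)
    (h09 : ∀ P : B12.RunParams, B12Sec2to5.Lemma4Printed (F12OfRecord₁₂ F N (theta13LiveOfFamily₂ F N ε₀ ε₂₉ ζ Rz Zt).toStage12Params lam12 P) (lam12 P).consts)
    (h09T : ∀ P : B12.RunParams, (leavesP w P).smallCouplings → (leavesP w P).smallFieldInductive)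
    (h10 : ∀ P : B12.RunParams, B13LeafOfRecord (theta13LiveOfFamily₂ F N ε₀ ε₂₉ ζ Rz Zt).toStage3Params (lam13 P))
    (h11 : ∀ P : B12.RunParams, (leavesP w P).b7 → (leavesP w P).b8 → (leavesP w P).b9 → (leavesP w P).b10 → (leavesP w P).b11 →
      (leavesP w P).smallCouplings → (leavesP w P).smallFieldInductive → (leavesP w P).flowControl →
        ∀ k, k < P.K → SLaw₁₃ F N (theta13LiveOfFamily₂ F N ε₀ ε₂₉ ζ Rz Zt) P k → TLaw₁₃ F N (theta13LiveOfFamily₂ F N ε₀ ε₂₉ ζ Rz Zt) P k)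
    (h12 : ∀ P : B12.RunParams, B15Leaf (WOfRecord₁₃ F N (theta13LiveOfFamily₂ F N ε₀ ε₂₉ ζ Rz Zt) lamW P))
    (hUV : ∀ P : B12.RunParams, (genFlow (betaOfRecord₁₃ F N (theta13LiveOfFamily₂ F N ε₀ ε₂₉ ζ Rz Zt)) P.g0).InInterval w.γ P.K → ∀ k, k ≤ P.K → SLaw₁₃ F N (theta13LiveOfFamily₂ F N ε₀ ε₂₉ ζ Rz Zt) P k →
      ∀ U : GaugeField (F.P P.K) k (SU N),
        chiβOfRecord₁₃ F N (theta13LiveOfFamily₂ F N ε₀ ε₂₉ ζ Rz Zt) P.K (gOfRecord₁₃ F N (theta13LiveOfFamily₂ F N ε₀ ε₂₉ ζ Rz Zt) P) k U *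
              Real.exp (-(1 / (gOfRecord₁₃ F N (theta13LiveOfFamily₂ F N ε₀ ε₂₉ ζ Rz Zt) P k) ^ 2 * wilsonBGOfRecord F N (theta13LiveOfFamily₂ F N ε₀ ε₂₉ ζ Rz Zt).εbg P k U)
                - w.em (gOfRecord₁₃ F N (theta13LiveOfFamily₂ F N ε₀ ε₂₉ ζ Rz Zt) P k) * (Fintype.card (Site (F.P P.K) k) : ℝ)) ≤ densOfRecord₁₃ F N (theta13LiveOfFamily₂ F N ε₀ ε₂₉ ζ Rz Zt) P k U ∧
        densOfRecord₁₃ F N (theta13LiveOfFamily₂ F N ε₀ ε₂₉ ζ Rz Zt) P k U ≤ Real.exp (w.ep (gOfRecord₁₃ F N (theta13LiveOfFamily₂ F N ε₀ ε₂₉ ζ Rz Zt) P k) * (Fintype.card (Site (F.P P.K) k) : ℝ)))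
    (hlo : BetaLowerH w.b w.γ (datumOfRecord₁₃ F N (theta13LiveOfFamily₂ F N ε₀ ε₂₉ ζ Rz Zt) hP).βfun)
    (hhi : BetaUpperH w.βup w.γ (datumOfRecord₁₃ F N (theta13LiveOfFamily₂ F N ε₀ ε₂₉ ζ Rz Zt) hP).βfun) :
    ∃ (θ' : Stage13Params F N) (h' : θ'.Provisos₁₃ F N) (w' : WorldP), (θ'.ZtUnity F N ∧ θ'.SlotsNondegenerate₁₃ F N) ∧ θ'.Admissible F N ∧
      IsRecordOfRecord₁₃C F N (datumOfRecord₁₃ F N θ' h') w' ∧ (∀ P : B12.RunParams, Nodes (leavesP w' P)) ∧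
      BetaBoundsInInterval w'.C.toB12 w'.γ w'.b w'.βup ∧
      ∃ γ₁ : ℝ, 0 < γ₁ ∧ ∀ γ : ℝ, 0 < γ → γ ≤ γ₁ → ∃ P : B12.RunParams, 1 ≤ P.K ∧ ((datumOfRecord₁₃ F N θ' h').C P).flow.InInterval γ P.K :=
  N24_betaWindowAtSomeRecord₁₃_of_rebindX_fourPin_pointed_theta13LiveOfFamily₂_of_boxH hε hε' ζ Rz Zt hP hZ (XPinned₁₃ F N (theta13LiveOfFamily₂ F N ε₀ ε₂₉ ζ Rz Zt) lam8 lam12 lam13) Mstar ops ζ9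
    lamW w hC hγ hL hup (fun P => (socket05_pinX3_iff F N (theta13LiveOfFamily₂ F N ε₀ ε₂₉ ζ Rz Zt) lam8 lam12 lam13 P).2 (h05 P)) h06 h07 h08 (fun P => (socket09_pinX3_iff F N
    (theta13LiveOfFamily₂ F N ε₀ ε₂₉ ζ Rz Zt) lam8 lam12 lam13 P).2 (h09 P)) h09T (fun P _ _ _ _ => (socket10_pinX3_iff F N (theta13LiveOfFamily₂ F N ε₀ ε₂₉ ζ Rz Zt) lam8 lam12 lam13 P).2 (h10
    P)) h11 h12 hUV hlo hhi

end Summit.QuantumFields.YangMills.BalabanUVNodes.N10XPinnedClosers13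

end
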